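import Literature.MathematicalPhysics.QuantumFieldTheory.Chatterjee2019LargeN.SymmetrizedLimitEquation
import HarnessLib

/-!
# Chatterjee 2019, Theorem 3.6 (the finite-`N` master loop equation) from Theorem 8.1 — the printed symmetrization, PROVED

S. Chatterjee, *Rigorous solution of strongly coupled `SO(N)` lattice gauge theory in the large `N` limit*,
Comm. Math. Phys. **366** (2019) 203–268 (arXiv:1502.07719), **Theorem 3.6** (finite `N` master loop equation):
«`(N−1)|s| φ(s) = Σ_{s'∈𝕋⁻(s)} φ(s') − Σ_{s'∈𝕋⁺(s)} φ(s') + N Σ_{s'∈𝕊⁻(s)} φ(s') − N Σ_{s'∈𝕊⁺(s)} φ(s') + N⁻¹ Σ_{s'∈𝕄⁻(s)} φ(s')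
− N⁻¹ Σ_{s'∈𝕄⁺(s)} φ(s') + Nβ Σ_{s'∈𝔻⁻(s)} φ(s') − Nβ Σ_{s'∈𝔻⁺(s)} φ(s')`», and its **proof at the end of §8** (held text
`paper:arxiv-1502.07719`, chunk `p0022`): «if `(l₁, …, lₙ)` is any representation of a loop sequence `s` (and not necessarily
the minimal representation), then `φ(s) = ⟨W_{l₁} ⋯ W_{lₙ}⟩/Nⁿ`. This is because of our convention that `W_∅ = N`»;
«`φ(l_{π(1)}, …, l_{π(n)}) = φ(l₁, …, lₙ)` for any permutation `π`»; «the master loop equation in Theorem 8.1 should hold true,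
with appropriate modifications on the right-hand side, if `l₁` is replaced by any other `l_k` and `e` is replaced by any
edge in `l_k`»; «Within the loop `l_k`, declare two edges to be equivalent if they are either equal or inverses of each other.
… Construct a set `D_k` by taking one member from each equivalence class and sum both sides … Since `Σ_{e∈D_k} m_k(e) = |l_k|`,
this gives [the equation for `(N−1)|l_k| φ(s)`] … Summing both sides of the above equation over `k`, we get the equation
claimed.»

THEOREMS ONLY (no new `Prop` fact; one auxiliary `def`, the index map `LoopSeq.skipIdx`):
★ `finiteNMasterLoopEquation_of_unsymmetrized : UnsymmetrizedMasterLoopEquation d → FiniteNMasterLoopEquation d` — the named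
fact `FiniteNMasterLoopEquation` (Theorem 3.6, sibling `StrongCoupling`) from the named fact `UnsymmetrizedMasterLoopEquation`
(Theorem 8.1, sibling `MasterLoopEquation`).

## How the printed proof is followed
* «any representation»: `soExpect_wilsonProd_eq` / `phi_prune` (sibling `MasterLoopLimit`), here `soExpect_front_eq`,
  `phi_replaceAt`: `⟨W(t)⟩ = N^{#t} φ(prune t)`.
* «permutation `π`»: `soExpect_wilsonProd_perm` (all lists), `phi_perm` (sibling `SymmetrizedLimitEquation`).
* «`l₁` replaced by `l_k`, `e` by any edge of `l_k`»: Theorem 8.1 is applied to `(l_k, s ∖ l_k)` (`LoopSeq.perm_get_cons_eraseIdx`).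
* «one member from each equivalence class; `Σ_{e∈D_k} m_k(e) = |l_k|`»: the average over all marked locations with weight
  `1/m_k(e)` (`Word.sum_marked_avg` and its instances for the pair, deformation and — new here — merger index sets,
  `Word.sum_marked_avg_merge`), giving `symmetrize_component_finiteN`.
* the powers of `N`: `sum_front_one` (twistings, deformations: `Nⁿ`), `sum_front_two` (splittings: `N^{n+1}`),
  `sum_front_merge` (mergers: `N^{n−1}`; the other component `l_r` of `s ∖ l_k` is re-indexed as a component `j ≠ k` of `s`,
  `LoopSeq.skipIdx` / `LoopSeq.sum_eraseIdx_eq_sum_ne`, and `(s with l_k ↦ l_k ⊙ l_j) ∖ l_j` is a permutation of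
  `(l_k ⊙ l_j, (s ∖ l_k) ∖ l_j)`, `LoopSeq.set_eraseIdx_perm`); the merger index type `𝕄^±(s)` of `LatticeStrings` is
  unfolded by `sum_mergeIdx_eq` (same undirected edge ⇔ equal or inverse letters, `DEdge.fst_eq_iff`).
* «summing over `k`»: the main proof; finally `N^{n−1}` is cancelled and the identity divided by `N`.

## WHAT THIS IS NOT
Theorem 8.1 itself (Stein's method / integration by parts on `SO(N)`, §§5–8) remains a named fact; nothing here bears on
four-dimensional Yang–Mills or a mass gap.

## References
* S. Chatterjee, Comm. Math. Phys. **366** (2019) 203–268, doi:10.1007/s00220-019-03353-3, arXiv:1502.07719 — Theorem 3.6,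
  §8 (proof of Theorem 3.6 from Theorem 8.1), §2.2 (the operation sets). [Chatterjee2019LargeN]
-/

noncomputable section

open Filter Topology
open Literature.Probability.LatticeModels Literature.MathematicalPhysics.QuantumLattice

namespace Literature.MathematicalPhysics.QuantumFieldTheory.Chatterjee2019LargeN

variable {d : ℕ}

namespace Word

/-- For `x ∈ C(e)` (in `l`) and any word `w`: the class of `l_x` in `w` is the class of `e` in `w`.
[cite: Chatterjee2019LargeN, proof of Theorem 3.6 (C_r(e) for the other components)] -/
theorem locs_get_eq_of_mem_locs {l : Word d} {e : DEdge d} {x : Fin l.length} (w : Word d) (h : x ∈ locs l e) :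
    locs w (l.get x) = locs w e := by
  rcases (mem_locs_iff l e x).1 h with h | h
  · rw [h]
  · rw [h, locs_inv]

/-- Averaged over the marking, the merger index set `C₁(e) × C_r(e)` becomes ALL pairs (location `x` of `l`, location
`y` of `l_r` carrying `l_x^{±1}`) (the component's part of `𝕄^±(s)`). [cite: Chatterjee2019LargeN, proof of Theorem 3.6 (the sets 𝕄^±_k(s))] -/
theorem sum_marked_avg_merge (l : Word d) (r : LoopSeq d)
    (G : Fin l.length → (j : Fin r.length) → Fin (r.get j).length → ℝ) :
    ∑ x₀ : Fin l.length, ((occ l (l.get x₀) : ℝ)⁻¹ *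
        ∑ j : Fin r.length, ∑ x ∈ locs l (l.get x₀), ∑ y ∈ locs (r.get j) (l.get x₀), G x j y)
      = ∑ x : Fin l.length, ∑ j : Fin r.length, ∑ y ∈ locs (r.get j) (l.get x), G x j y := by
  have h1 : ∀ x₀ : Fin l.length,
      ∑ j : Fin r.length, ∑ x ∈ locs l (l.get x₀), ∑ y ∈ locs (r.get j) (l.get x₀), G x j y
        = ∑ x ∈ locs l (l.get x₀), ∑ j : Fin r.length, ∑ y ∈ locs (r.get j) (l.get x), G x j y := by
    intro x₀
    rw [Finset.sum_comm]
    exact Finset.sum_congr rfl fun x hx => Finset.sum_congr rfl fun j _ => by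
      rw [locs_get_eq_of_mem_locs (r.get j) hx]
  simp only [h1]
  exact sum_marked_avg l Finset.univ (fun e => locs l e) id _ fun x₀ x => by
    simp only [Finset.mem_univ, true_and, id]
    exact mem_locs_comm l x x₀

end Word

/-- `⟨W_{l₁} ⋯ W_{lₙ}⟩_{Λ,N,β}` does not depend on the order of the (possibly null) loops.
[cite: Chatterjee2019LargeN, proof of Theorem 3.6 («φ(l_{π(1)}, …, l_{π(n)}) = φ(l₁, …, lₙ)»)] -/
theorem soExpect_wilsonProd_perm (N : ℕ) (β : ℝ) (Λ : Finset (Literature.Probability.LatticeModels.Site d))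
    {s t : LoopSeq d} (h : s.Perm t) : soExpect N β Λ (wilsonProd N s) = soExpect N β Λ (wilsonProd N t) := by
  have hw : wilsonProd N s = wilsonProd N t := by
    funext U
    exact (h.map _).prod_eq
  rw [hw]

/-- **Theorem 8.1 symmetrized over the marked edge of one component (front form).**  For a genuine loop sequence `s`
inside `Λ` and a component `i` (write `l = lᵢ`, `rest = s ∖ lᵢ`):
`(N−1)|lᵢ| ⟨W(s)⟩ = Σ_{x≠y, same letter} ⟨W(∝⁻ lᵢ, rest)⟩ − Σ_{inverse letters} ⟨W(∝⁺ lᵢ, rest)⟩ + Σ_{inverse} ⟨W(×¹, ×², rest)⟩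
 − Σ_{same} ⟨W(×¹, ×², rest)⟩ + Σ_{x, r, y ∈ C_r(l_x)} ⟨W(lᵢ ⊖_{x,y} l_r, rest ∖ l_r)⟩ − (⊕) + Nβ Σ_{x,p} ⟨W(lᵢ ⊖ₓ p, rest)⟩ − Nβ (⊕)`
— the printed «sum both sides over the set `D_k` of class representatives; `Σ_{e∈D_k} m_k(e) = |l_k|`», here as the average
over all marked locations with weight `1/m`. [cite: Chatterjee2019LargeN, proof of Theorem 3.6 (the display for (N−1)|l_k| φ(s))] -/
theorem symmetrize_component_finiteN (hU : UnsymmetrizedMasterLoopEquation d) (hd : 2 ≤ d)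
    (Λ : Finset (Literature.Probability.LatticeModels.Site d)) (N : ℕ) (hN : 2 ≤ N) (β : ℝ)
    {s : LoopSeq d} (hs : IsLoopSeq s)
    (hΛ : ∀ l ∈ s, ∀ a ∈ l, ∀ v : Literature.Probability.LatticeModels.Site d,
      latticeNorm (v - DEdge.src a) ≤ 1 ∨ latticeNorm (v - DEdge.tgt a) ≤ 1 → v ∈ Λ)
    (i : Fin s.length) :
    ((N : ℝ) - 1) * ((s.get i).length : ℝ) * soExpect N β Λ (wilsonProd N s) =
      (∑ xy ∈ Finset.univ.filter
          (fun xy : Fin (s.get i).length × Fin (s.get i).length => xy.1 ≠ xy.2 ∧ (s.get i).get xy.2 = (s.get i).get xy.1),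
          soExpect N β Λ (wilsonProd N (Word.negTwist (s.get i) xy.1 xy.2 :: s.eraseIdx i)))
      - (∑ xy ∈ Finset.univ.filter
          (fun xy : Fin (s.get i).length × Fin (s.get i).length => (s.get i).get xy.2 = DEdge.inv ((s.get i).get xy.1)),
          soExpect N β Λ (wilsonProd N (Word.posTwist (s.get i) xy.1 xy.2 :: s.eraseIdx i)))
      + (∑ xy ∈ Finset.univ.filter
          (fun xy : Fin (s.get i).length × Fin (s.get i).length => (s.get i).get xy.2 = DEdge.inv ((s.get i).get xy.1)),
          soExpect N β Λ (wilsonProd N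
            (Word.negSplit₁ (s.get i) xy.1 xy.2 :: Word.negSplit₂ (s.get i) xy.1 xy.2 :: s.eraseIdx i)))
      - (∑ xy ∈ Finset.univ.filter
          (fun xy : Fin (s.get i).length × Fin (s.get i).length => xy.1 ≠ xy.2 ∧ (s.get i).get xy.2 = (s.get i).get xy.1),
          soExpect N β Λ (wilsonProd N
            (Word.posSplit₁ (s.get i) xy.1 xy.2 :: Word.posSplit₂ (s.get i) xy.1 xy.2 :: s.eraseIdx i)))
      + (∑ x : Fin (s.get i).length, ∑ j : Fin (s.eraseIdx i).length,
          ∑ y ∈ Word.locs ((s.eraseIdx ↑i).get j) ((s.get i).get x),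
          soExpect N β Λ (wilsonProd N
            (Word.negMerge (s.get i) x ((s.eraseIdx ↑i).get j) y :: (s.eraseIdx ↑i).eraseIdx j)))
      - (∑ x : Fin (s.get i).length, ∑ j : Fin (s.eraseIdx i).length,
          ∑ y ∈ Word.locs ((s.eraseIdx ↑i).get j) ((s.get i).get x),
          soExpect N β Λ (wilsonProd N
            (Word.posMerge (s.get i) x ((s.eraseIdx ↑i).get j) y :: (s.eraseIdx ↑i).eraseIdx j)))
      + N * β * (∑ x : Fin (s.get i).length, ∑ p ∈ plaquettesAt ((s.get i).get x),
          soExpect N β Λ (wilsonProd N (Word.negDeform (s.get i) x p :: s.eraseIdx i)))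
      - N * β * (∑ x : Fin (s.get i).length, ∑ p ∈ plaquettesAt ((s.get i).get x),
          soExpect N β Λ (wilsonProd N (Word.posDeform (s.get i) x p :: s.eraseIdx i))) := by
  have hp : s.Perm (s.get i :: s.eraseIdx i) := LoopSeq.perm_get_cons_eraseIdx s i
  have hs' : IsLoopSeq (s.get i :: s.eraseIdx i) := hs.perm hp
  have hΛ' : ∀ l ∈ s.get i :: s.eraseIdx i, ∀ a ∈ l, ∀ v : Literature.Probability.LatticeModels.Site d,
      latticeNorm (v - DEdge.src a) ≤ 1 ∨ latticeNorm (v - DEdge.tgt a) ≤ 1 → v ∈ Λ :=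
    fun l hl => hΛ l (hp.mem_iff.2 hl)
  -- the marked equation at each location, divided by the multiplicity
  have hx : ∀ x₀ : Fin (s.get i).length, ((N : ℝ) - 1) * soExpect N β Λ (wilsonProd N s) =
      (Word.occ (s.get i) ((s.get i).get x₀) : ℝ)⁻¹ *
          twistTermAt (fun s' => soExpect N β Λ (wilsonProd N s')) (s.get i) (s.eraseIdx i) ((s.get i).get x₀)
        + (Word.occ (s.get i) ((s.get i).get x₀) : ℝ)⁻¹ *
          splitTermAt (fun s' => soExpect N β Λ (wilsonProd N s')) (s.get i) (s.eraseIdx i) ((s.get i).get x₀)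
        + (Word.occ (s.get i) ((s.get i).get x₀) : ℝ)⁻¹ *
          mergeTermAt (fun s' => soExpect N β Λ (wilsonProd N s')) (s.get i) (s.eraseIdx i) ((s.get i).get x₀)
        + N * β * ((Word.occ (s.get i) ((s.get i).get x₀) : ℝ)⁻¹ *
          deformTermAt (fun s' => soExpect N β Λ (wilsonProd N s')) (s.get i) (s.eraseIdx i) ((s.get i).get x₀)) := by
    intro x₀
    have h := hU hd Λ N hN β (s.get i) (s.eraseIdx i) hs' hΛ' x₀
    have h0 : (Word.occ (s.get i) ((s.get i).get x₀) : ℝ) ≠ 0 := by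
      exact_mod_cast (Word.occ_get_pos (s.get i) x₀).ne'
    rw [soExpect_wilsonProd_perm N β Λ hp]
    field_simp
    linear_combination h
  rw [show ((N : ℝ) - 1) * ((s.get i).length : ℝ) * soExpect N β Λ (wilsonProd N s)
      = ∑ _x₀ : Fin (s.get i).length, ((N : ℝ) - 1) * soExpect N β Λ (wilsonProd N s) by
        rw [Finset.sum_const, Finset.card_univ, Fintype.card_fin, nsmul_eq_mul]; ring,
    Finset.sum_congr rfl fun x₀ _ => hx x₀]
  simp only [Finset.sum_add_distrib, ← Finset.mul_sum, twistTermAt, splitTermAt, mergeTermAt, deformTermAt, mul_sub,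
    Finset.sum_sub_distrib, Word.sum_marked_avg_invPairs, Word.sum_marked_avg_samePairs, Word.sum_marked_avg_deform,
    Word.sum_marked_avg_merge]
  ring

/-! ### From `⟨W⟩` of front-form lists to `φ_{Λ,N,β}` of the operation results -/

/-- `φ(s with lᵢ ↦ ws) = φ(ws, s ∖ lᵢ)` (reordering and deleting null loops do not change `φ`). [cite: Chatterjee2019LargeN, proof of Theorem 3.6 (first two displays)] -/
theorem phi_replaceAt (N : ℕ) (hN : N ≠ 0) (β : ℝ) (Λ : Finset (Literature.Probability.LatticeModels.Site d))
    (s : LoopSeq d) (i : Fin s.length) (ws : List (Word d)) :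
    phi N β Λ (s.replaceAt i ws) = phi N β Λ (ws ++ s.eraseIdx i) := by
  rw [phi_perm N β Λ (LoopSeq.replaceAt_perm_prune s i ws), ← phi_prune N hN]

/-- `⟨W(ws, s ∖ lᵢ)⟩ = φ(s with lᵢ ↦ ws) · N^{#ws + n − 1}`. [cite: Chatterjee2019LargeN, proof of Theorem 3.6 («φ(s) = ⟨W_{l₁} ⋯ W_{lₙ}⟩/Nⁿ» for any representation)] -/
theorem soExpect_front_eq (N : ℕ) (hN : N ≠ 0) (β : ℝ) (Λ : Finset (Literature.Probability.LatticeModels.Site d))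
    (s : LoopSeq d) (i : Fin s.length) (ws : List (Word d)) :
    soExpect N β Λ (wilsonProd N (ws ++ s.eraseIdx i)) =
      phi N β Λ (s.replaceAt i ws) * (N : ℝ) ^ (ws.length + (s.eraseIdx i).length) := by
  rw [soExpect_wilsonProd_eq N hN, List.length_append, phi_replaceAt N hN]

/-- `#(s ∖ lᵢ) + 1 = #s`. [cite: Chatterjee2019LargeN, §2.1 (loop sequences)] -/
theorem LoopSeq.length_eraseIdx_add_one (s : LoopSeq d) (i : Fin s.length) : (s.eraseIdx i).length + 1 = s.length := by
  have h := (LoopSeq.perm_get_cons_eraseIdx s i).length_eq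
  rw [List.length_cons] at h
  exact h.symm

/-- Two directed edges carry the same undirected edge iff they are equal or inverse to each other.
[cite: Chatterjee2019LargeN, §2 ¶1 (e and e⁻¹)] -/
theorem DEdge.fst_eq_iff (f e : DEdge d) : f.1 = e.1 ↔ (f = e ∨ f = DEdge.inv e) := by
  constructor
  · intro h
    rcases f with ⟨f1, fb⟩
    rcases e with ⟨e1, eb⟩
    simp only at h
    subst h
    cases fb <;> cases eb <;> simp [DEdge.inv]
  · rintro (h | h)
    · rw [h]
    · rw [h]; rfl

/-- The merger condition «same undirected edge at `y`» is membership in the class `C(e)`.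
[cite: Chatterjee2019LargeN, §2.2 (mergers), Theorem 8.1 (C_r)] -/
theorem Word.locs_eq_filter_fst (w : Word d) (e : DEdge d) :
    Word.locs w e = Finset.univ.filter (fun y : Fin w.length => (w.get y).1 = e.1) := by
  ext y
  simp only [Word.locs, Finset.mem_filter, Finset.mem_univ, true_and, DEdge.fst_eq_iff]

/-! ### Reindexing the other components: `s ∖ lᵢ` versus `{j ≠ i}` -/

/-- Position in `s` of the `j₀`-th loop of `s ∖ lᵢ`. [cite: Chatterjee2019LargeN, proof of Theorem 3.6 (the sums over r ≠ k)] -/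
def LoopSeq.skipIdx (s : LoopSeq d) (i : Fin s.length) (j₀ : Fin (s.eraseIdx i).length) : Fin s.length :=
  ⟨if (j₀ : ℕ) < i then j₀ else j₀ + 1, by
    have := LoopSeq.length_eraseIdx_add_one s i
    have := j₀.isLt
    split_ifs <;> omega⟩

/-- The re-indexed component is not `i`. [cite: Chatterjee2019LargeN, proof of Theorem 3.6 (r ≠ k)] -/
theorem LoopSeq.skipIdx_ne (s : LoopSeq d) (i : Fin s.length) (j₀ : Fin (s.eraseIdx i).length) : i ≠ s.skipIdx i j₀ := by
  intro h
  have h' := congrArg Fin.val h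
  simp only [LoopSeq.skipIdx] at h'
  split_ifs at h' with hlt <;> omega

/-- The `j₀`-th loop of `s ∖ lᵢ` is the `skipIdx i j₀`-th loop of `s`. [cite: Chatterjee2019LargeN, proof of Theorem 3.6 (the components l_r, r ≠ k)] -/
theorem LoopSeq.get_skipIdx (s : LoopSeq d) (i : Fin s.length) (j₀ : Fin (s.eraseIdx i).length) :
    s.get (s.skipIdx i j₀) = (s.eraseIdx i).get j₀ := by
  simp only [LoopSeq.skipIdx, List.get_eq_getElem, List.getElem_eraseIdx]
  split_ifs <;> rfl

/-- Reindexing a sum over the loops of `s ∖ lᵢ` as a sum over the components `j ≠ i` of `s`.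
[cite: Chatterjee2019LargeN, proof of Theorem 3.6 (Σ_{k<r≤n} + Σ_{1≤r<k})] -/
theorem LoopSeq.sum_eraseIdx_eq_sum_ne (s : LoopSeq d) (i : Fin s.length) (Φ : Fin s.length → ℝ)
    (Ψ : Fin (s.eraseIdx i).length → ℝ) (h : ∀ j₀, Ψ j₀ = Φ (s.skipIdx i j₀)) :
    ∑ j₀, Ψ j₀ = ∑ j ∈ Finset.univ.filter (fun j : Fin s.length => i ≠ j), Φ j := by
  have hlen := LoopSeq.length_eraseIdx_add_one s i
  refine Finset.sum_bij' (fun j₀ _ => s.skipIdx i j₀)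
    (fun j hj => ⟨if (j : ℕ) < i then j else j - 1, by
      rw [Finset.mem_filter] at hj
      have h1 : (i : ℕ) ≠ j := fun h => hj.2 (Fin.ext h)
      have := j.isLt
      split_ifs <;> omega⟩)
    (fun j₀ _ => by simpa using LoopSeq.skipIdx_ne s i j₀)
    (fun _ _ => Finset.mem_univ _)
    (fun j₀ _ => by
      apply Fin.ext
      simp only [LoopSeq.skipIdx, Fin.val_mk]
      split_ifs <;> omega)
    (fun j hj => by
      rw [Finset.mem_filter] at hj
      have h1 : (i : ℕ) ≠ j := fun h => hj.2 (Fin.ext h)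
      apply Fin.ext
      simp only [LoopSeq.skipIdx, Fin.val_mk]
      split_ifs <;> omega)
    (fun j₀ _ => h j₀)

/-- **Erasing the merged partner.**  `(s with lᵢ ↦ M) ∖ l_j` is a permutation of `(M, (s ∖ lᵢ) ∖ l_j)` (with `j`'s position
recomputed in `s ∖ lᵢ`). [cite: Chatterjee2019LargeN, §2.2 (s' a merger of s: lᵢ replaced, l_j deleted), proof of Theorem 3.6] -/
theorem LoopSeq.set_eraseIdx_perm (s : LoopSeq d) (M : Word d) (i : Fin s.length) (j₀ : Fin (s.eraseIdx i).length) :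
    ((s.set i M).eraseIdx (s.skipIdx i j₀)).Perm (M :: (s.eraseIdx i).eraseIdx j₀) := by
  have hlen := LoopSeq.length_eraseIdx_add_one s i
  have hj₀ := j₀.isLt
  have hi := i.isLt
  -- position of `M` inside `u := (s with lᵢ ↦ M) ∖ l_j`
  obtain ⟨i'', hA⟩ : ∃ i'' : ℕ, ((i : ℕ) ≤ j₀ ∧ i'' = i) ∨ ((j₀ : ℕ) < i ∧ i'' + 1 = i) := by
    by_cases h : (i : ℕ) ≤ j₀
    · exact ⟨i, Or.inl ⟨h, rfl⟩⟩
    · exact ⟨i - 1, Or.inr ⟨lt_of_not_ge h, by omega⟩⟩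
  have hul : ((s.set i M).eraseIdx (s.skipIdx i j₀)).length + 1 = s.length := by
    have h := LoopSeq.length_eraseIdx_add_one (s.set i M) ⟨s.skipIdx i j₀, by simp⟩
    simpa using h
  have hi''lt : i'' < ((s.set i M).eraseIdx (s.skipIdx i j₀)).length := by omega
  have hperm := LoopSeq.perm_get_cons_eraseIdx ((s.set i M).eraseIdx (s.skipIdx i j₀)) ⟨i'', hi''lt⟩
  have hget : ((s.set i M).eraseIdx (s.skipIdx i j₀)).get ⟨i'', hi''lt⟩ = M := by
    simp only [LoopSeq.skipIdx, List.get_eq_getElem, List.getElem_eraseIdx, List.getElem_set]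
    split_ifs <;> first | rfl | (exfalso; omega)
  have herase : ((s.set i M).eraseIdx (s.skipIdx i j₀)).eraseIdx i'' = (s.eraseIdx i).eraseIdx j₀ := by
    apply List.ext_getElem
    · have h1 := LoopSeq.length_eraseIdx_add_one ((s.set i M).eraseIdx (s.skipIdx i j₀)) ⟨i'', hi''lt⟩
      have h2 := LoopSeq.length_eraseIdx_add_one (s.eraseIdx i) j₀
      simp only at h1 h2
      omega
    · intro k hk1 hk2
      simp only [LoopSeq.skipIdx, List.getElem_eraseIdx, List.getElem_set]
      split_ifs
      all_goals
        repeat' (first | rfl | (exfalso; omega) | split)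
  rw [hget, herase] at hperm
  exact hperm

/-! ### Conversions: front-form `⟨W⟩`-sums to `φ`-sums over the operation index types -/

section Conversions

variable (N : ℕ) (hN : N ≠ 0) (β : ℝ) (Λ : Finset (Literature.Probability.LatticeModels.Site d))

include hN in
/-- One new loop in place of `lᵢ`: `Σ ⟨W(w, s ∖ lᵢ)⟩ = Nⁿ Σ φ(s with lᵢ ↦ w)`. [cite: Chatterjee2019LargeN, proof of Theorem 3.6 (twisting and deformation terms: n loops)] -/
theorem sum_front_one {ι : Type*} (s : LoopSeq d) (i : Fin s.length) (T : Finset ι) (w : ι → Word d) :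
    ∑ a ∈ T, soExpect N β Λ (wilsonProd N (w a :: s.eraseIdx i))
      = (N : ℝ) ^ s.length * ∑ a ∈ T, phi N β Λ (s.replaceAt i [w a]) := by
  rw [Finset.mul_sum]
  refine Finset.sum_congr rfl fun a _ => ?_
  rw [show w a :: s.eraseIdx i = [w a] ++ s.eraseIdx i from rfl, soExpect_front_eq N hN, List.length_singleton,
    add_comm, LoopSeq.length_eraseIdx_add_one, mul_comm]

include hN in
/-- Two new loops in place of `lᵢ`: `Σ ⟨W(w₁, w₂, s ∖ lᵢ)⟩ = N^{n+1} Σ φ(s with lᵢ ↦ (w₁, w₂))`. [cite: Chatterjee2019LargeN, proof of Theorem 3.6 (splitting term: factor N)] -/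
theorem sum_front_two {ι : Type*} (s : LoopSeq d) (i : Fin s.length) (T : Finset ι) (w₁ w₂ : ι → Word d) :
    ∑ a ∈ T, soExpect N β Λ (wilsonProd N (w₁ a :: w₂ a :: s.eraseIdx i))
      = (N : ℝ) ^ (s.length + 1) * ∑ a ∈ T, phi N β Λ (s.replaceAt i [w₁ a, w₂ a]) := by
  rw [Finset.mul_sum]
  refine Finset.sum_congr rfl fun a _ => ?_
  rw [show w₁ a :: w₂ a :: s.eraseIdx i = [w₁ a, w₂ a] ++ s.eraseIdx i from rfl, soExpect_front_eq N hN,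
    show [w₁ a, w₂ a].length + (s.eraseIdx ↑i).length = s.length + 1 by
      have := LoopSeq.length_eraseIdx_add_one s i; simp; omega, mul_comm]

include hN in
/-- Mergers with the other components, front form versus in place: `Σ_{x, r, y} ⟨W(lᵢ ⊙ l_r, s ∖ {lᵢ, l_r})⟩ =
N^{n−1} Σ_{j ≠ i, x, y} φ((s with lᵢ ↦ lᵢ ⊙ l_j) ∖ l_j)`. [cite: Chatterjee2019LargeN, proof of Theorem 3.6 (merger term: factor 1/N)] -/
theorem sum_front_merge (s : LoopSeq d) (i : Fin s.length)
    (op : (l : Word d) → Fin l.length → (l' : Word d) → Fin l'.length → Word d) :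
    ∑ x : Fin (s.get i).length, ∑ j₀ : Fin (s.eraseIdx i).length,
        ∑ y ∈ Word.locs ((s.eraseIdx ↑i).get j₀) ((s.get i).get x),
          soExpect N β Λ (wilsonProd N (op (s.get i) x ((s.eraseIdx ↑i).get j₀) y :: (s.eraseIdx ↑i).eraseIdx j₀))
      = (N : ℝ) ^ (s.length - 1) * ∑ j ∈ Finset.univ.filter (fun j : Fin s.length => i ≠ j),
          ∑ x : Fin (s.get i).length, ∑ y ∈ Word.locs (s.get j) ((s.get i).get x),
            phi N β Λ ((s.set i (op (s.get i) x (s.get j) y)).eraseIdx j) := by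
  rw [Finset.sum_comm, Finset.mul_sum]
  refine LoopSeq.sum_eraseIdx_eq_sum_ne s i _ _ fun j₀ => ?_
  rw [LoopSeq.get_skipIdx, Finset.mul_sum]
  refine Finset.sum_congr rfl fun x _ => ?_
  rw [Finset.mul_sum]
  refine Finset.sum_congr rfl fun y _ => ?_
  have h1 := LoopSeq.length_eraseIdx_add_one (s.eraseIdx i) j₀
  have h2 := LoopSeq.length_eraseIdx_add_one s i
  rw [soExpect_wilsonProd_eq N hN, ← phi_perm N β Λ (LoopSeq.set_eraseIdx_perm s _ i j₀), List.length_cons, h1,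
    show (s.eraseIdx ↑i).length = s.length - 1 by omega, mul_comm]

include hN in
/-- The merger sums over `𝕄^±(s)` as componentwise sums over `j ≠ i`, `x`, `y ∈ C_j(l_x)`. [cite: Chatterjee2019LargeN, §2.2 (𝕄^±(s): ordered pairs of components, counting), proof of Theorem 3.6] -/
theorem sum_mergeIdx_eq (s : LoopSeq d)
    (op : (l : Word d) → Fin l.length → (l' : Word d) → Fin l'.length → Word d) :
    ∑ o : MergeIdx s, phi N β Λ
        (LoopSeq.prune ((s.set o.1 (op (s.get o.1) o.2.2.1.1 (s.get o.2.1) o.2.2.1.2)).eraseIdx o.2.1))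
      = ∑ i : Fin s.length, ∑ j ∈ Finset.univ.filter (fun j : Fin s.length => i ≠ j),
          ∑ x : Fin (s.get i).length, ∑ y ∈ Word.locs (s.get j) ((s.get i).get x),
            phi N β Λ ((s.set i (op (s.get i) x (s.get j) y)).eraseIdx j) := by
  rw [Fintype.sum_sigma]
  refine Finset.sum_congr rfl fun i _ => ?_
  rw [Fintype.sum_sigma, Finset.sum_filter]
  refine Finset.sum_congr rfl fun j _ => ?_
  by_cases hij : i = j
  · rw [if_neg (not_not.mpr hij)]
    haveI : IsEmpty {xy : Fin (s.get i).length × Fin (s.get j).length //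
        i ≠ j ∧ ((s.get j).get xy.2).1 = ((s.get i).get xy.1).1} := ⟨fun q => q.2.1 hij⟩
    exact Fintype.sum_empty _
  · rw [if_pos hij]
    calc ∑ q : {xy : Fin (s.get i).length × Fin (s.get j).length //
            i ≠ j ∧ ((s.get j).get xy.2).1 = ((s.get i).get xy.1).1},
            phi N β Λ (LoopSeq.prune ((s.set i (op (s.get i) q.1.1 (s.get j) q.1.2)).eraseIdx j))
        = ∑ xy ∈ Finset.univ.filter (fun xy : Fin (s.get i).length × Fin (s.get j).length =>
            i ≠ j ∧ ((s.get j).get xy.2).1 = ((s.get i).get xy.1).1),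
            phi N β Λ (LoopSeq.prune ((s.set i (op (s.get i) xy.1 (s.get j) xy.2)).eraseIdx j)) := by
          symm
          apply Finset.sum_subtype
          intro xy
          simp
      _ = ∑ xy ∈ Finset.univ.filter (fun xy : Fin (s.get i).length × Fin (s.get j).length =>
            ((s.get j).get xy.2).1 = ((s.get i).get xy.1).1),
            phi N β Λ ((s.set i (op (s.get i) xy.1 (s.get j) xy.2)).eraseIdx j) := by
          refine Finset.sum_congr ?_ fun xy _ => (phi_prune N hN β Λ _).symm
          ext xy
          simp [hij]
      _ = ∑ x : Fin (s.get i).length, ∑ y ∈ Word.locs (s.get j) ((s.get i).get x),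
            phi N β Λ ((s.set i (op (s.get i) x (s.get j) y)).eraseIdx j) := by
          rw [Finset.sum_filter, ← Finset.univ_product_univ, Finset.sum_product]
          refine Finset.sum_congr rfl fun x _ => ?_
          rw [Word.locs_eq_filter_fst, Finset.sum_filter]

end Conversions

/-- ★ **Chatterjee 2019, Theorem 3.6 (finite-`N` master loop equation) from Theorem 8.1, PROVED — the printed proof
(§8, last two pages).**  For a genuine non-null loop sequence `s` inside `Λ`:
`(N−1)|s| φ(s) = Σ_{𝕋⁻} φ − Σ_{𝕋⁺} φ + N Σ_{𝕊⁻} φ − N Σ_{𝕊⁺} φ + N⁻¹ Σ_{𝕄⁻} φ − N⁻¹ Σ_{𝕄⁺} φ + Nβ Σ_{𝔻⁻} φ − Nβ Σ_{𝔻⁺} φ`.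
Steps as printed: `⟨W⟩` is permutation invariant and `⟨W(l₁,…)⟩ = N^{#} φ(minimal representation)` (`W_∅ = N`);
Theorem 8.1 at every component `l_k` and every edge of `l_k` (`symmetrize_component_finiteN`: the class average replaces
the representatives `D_k`); the powers of `N`: `n` loops for twistings/deformations, `n+1` for splittings, `n−1` for
mergers; sum over `k`.  The named fact `FiniteNMasterLoopEquation` (sibling `StrongCoupling`) thus follows from
`UnsymmetrizedMasterLoopEquation` alone. [cite: Chatterjee2019LargeN, Theorem 3.6 and its proof at the end of §8; Theorem 8.1] -/
theorem finiteNMasterLoopEquation_of_unsymmetrized (hU : UnsymmetrizedMasterLoopEquation d) :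
    FiniteNMasterLoopEquation d := by
  intro hd Λ _ N hN β s hs hne hΛ
  have hN0 : N ≠ 0 := by omega
  have hNr : (N : ℝ) ≠ 0 := by exact_mod_cast hN0
  have hn1 : 1 ≤ s.length := List.length_pos_iff.mpr hne
  set P : ℝ := (N : ℝ) ^ (s.length - 1) with hP
  have hP0 : P ≠ 0 := pow_ne_zero _ hNr
  have hPn : (N : ℝ) ^ s.length = P * N := by
    rw [hP, ← pow_succ]; congr 1; omega
  have hPn1 : (N : ℝ) ^ (s.length + 1) = P * N * N := by
    rw [pow_succ, hPn]
  -- index-type sums as componentwise filtered sums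
  have hTn : ∑ o : SameIdx s, phi N β Λ (s.negTwistAt o) = ∑ i : Fin s.length, ∑ xy ∈ Finset.univ.filter
      (fun xy : Fin (s.get i).length × Fin (s.get i).length => xy.1 ≠ xy.2 ∧ (s.get i).get xy.2 = (s.get i).get xy.1),
      phi N β Λ (s.replaceAt i [Word.negTwist (s.get i) xy.1 xy.2]) := by
    rw [Fintype.sum_sigma]
    refine Finset.sum_congr rfl fun i _ => ?_
    symm
    apply Finset.sum_subtype
    intro xy
    simp
  have hTp : ∑ o : InvIdx s, phi N β Λ (s.posTwistAt o) = ∑ i : Fin s.length, ∑ xy ∈ Finset.univ.filter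
      (fun xy : Fin (s.get i).length × Fin (s.get i).length => (s.get i).get xy.2 = DEdge.inv ((s.get i).get xy.1)),
      phi N β Λ (s.replaceAt i [Word.posTwist (s.get i) xy.1 xy.2]) := by
    rw [Fintype.sum_sigma]
    refine Finset.sum_congr rfl fun i _ => ?_
    symm
    apply Finset.sum_subtype
    intro xy
    simp
  have hSn : ∑ o : InvIdx s, phi N β Λ (s.negSplitAt o) = ∑ i : Fin s.length, ∑ xy ∈ Finset.univ.filter
      (fun xy : Fin (s.get i).length × Fin (s.get i).length => (s.get i).get xy.2 = DEdge.inv ((s.get i).get xy.1)),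
      phi N β Λ (s.replaceAt i [Word.negSplit₁ (s.get i) xy.1 xy.2, Word.negSplit₂ (s.get i) xy.1 xy.2]) := by
    rw [Fintype.sum_sigma]
    refine Finset.sum_congr rfl fun i _ => ?_
    symm
    apply Finset.sum_subtype
    intro xy
    simp
  have hSp : ∑ o : SameIdx s, phi N β Λ (s.posSplitAt o) = ∑ i : Fin s.length, ∑ xy ∈ Finset.univ.filter
      (fun xy : Fin (s.get i).length × Fin (s.get i).length => xy.1 ≠ xy.2 ∧ (s.get i).get xy.2 = (s.get i).get xy.1),
      phi N β Λ (s.replaceAt i [Word.posSplit₁ (s.get i) xy.1 xy.2, Word.posSplit₂ (s.get i) xy.1 xy.2]) := by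
    rw [Fintype.sum_sigma]
    refine Finset.sum_congr rfl fun i _ => ?_
    symm
    apply Finset.sum_subtype
    intro xy
    simp
  have hDn : ∑ o : DeformIdx s, phi N β Λ (s.negDeformAt o) = ∑ i : Fin s.length, ∑ x : Fin (s.get i).length,
      ∑ p ∈ plaquettesAt ((s.get i).get x), phi N β Λ (s.replaceAt i [Word.negDeform (s.get i) x p]) := by
    rw [Fintype.sum_sigma]
    refine Finset.sum_congr rfl fun i _ => ?_
    rw [Fintype.sum_sigma]
    refine Finset.sum_congr rfl fun x _ => ?_
    exact Finset.sum_coe_sort (plaquettesAt ((s.get i).get x))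
      (fun p => phi N β Λ (s.replaceAt i [Word.negDeform (s.get i) x p]))
  have hDp : ∑ o : DeformIdx s, phi N β Λ (s.posDeformAt o) = ∑ i : Fin s.length, ∑ x : Fin (s.get i).length,
      ∑ p ∈ plaquettesAt ((s.get i).get x), phi N β Λ (s.replaceAt i [Word.posDeform (s.get i) x p]) := by
    rw [Fintype.sum_sigma]
    refine Finset.sum_congr rfl fun i _ => ?_
    rw [Fintype.sum_sigma]
    refine Finset.sum_congr rfl fun x _ => ?_
    exact Finset.sum_coe_sort (plaquettesAt ((s.get i).get x))
      (fun p => phi N β Λ (s.replaceAt i [Word.posDeform (s.get i) x p]))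
  have hMn : ∑ o : MergeIdx s, phi N β Λ (s.negMergeAt o) = ∑ i : Fin s.length,
      ∑ j ∈ Finset.univ.filter (fun j : Fin s.length => i ≠ j),
        ∑ x : Fin (s.get i).length, ∑ y ∈ Word.locs (s.get j) ((s.get i).get x),
          phi N β Λ ((s.set i (Word.negMerge (s.get i) x (s.get j) y)).eraseIdx j) :=
    sum_mergeIdx_eq N hN0 β Λ s Word.negMerge
  have hMp : ∑ o : MergeIdx s, phi N β Λ (s.posMergeAt o) = ∑ i : Fin s.length,
      ∑ j ∈ Finset.univ.filter (fun j : Fin s.length => i ≠ j),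
        ∑ x : Fin (s.get i).length, ∑ y ∈ Word.locs (s.get j) ((s.get i).get x),
          phi N β Λ ((s.set i (Word.posMerge (s.get i) x (s.get j) y)).eraseIdx j) :=
    sum_mergeIdx_eq N hN0 β Λ s Word.posMerge
  -- the component identities, converted to `φ` and summed over the components
  have hcomp : ∀ i : Fin s.length, ((N : ℝ) - 1) * ((s.get i).length : ℝ) * (phi N β Λ s * (P * N)) =
      P * N * (∑ xy ∈ Finset.univ.filter
          (fun xy : Fin (s.get i).length × Fin (s.get i).length => xy.1 ≠ xy.2 ∧ (s.get i).get xy.2 = (s.get i).get xy.1),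
          phi N β Λ (s.replaceAt i [Word.negTwist (s.get i) xy.1 xy.2]))
      - P * N * (∑ xy ∈ Finset.univ.filter
          (fun xy : Fin (s.get i).length × Fin (s.get i).length => (s.get i).get xy.2 = DEdge.inv ((s.get i).get xy.1)),
          phi N β Λ (s.replaceAt i [Word.posTwist (s.get i) xy.1 xy.2]))
      + P * N * N * (∑ xy ∈ Finset.univ.filter
          (fun xy : Fin (s.get i).length × Fin (s.get i).length => (s.get i).get xy.2 = DEdge.inv ((s.get i).get xy.1)),
          phi N β Λ (s.replaceAt i [Word.negSplit₁ (s.get i) xy.1 xy.2, Word.negSplit₂ (s.get i) xy.1 xy.2]))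
      - P * N * N * (∑ xy ∈ Finset.univ.filter
          (fun xy : Fin (s.get i).length × Fin (s.get i).length => xy.1 ≠ xy.2 ∧ (s.get i).get xy.2 = (s.get i).get xy.1),
          phi N β Λ (s.replaceAt i [Word.posSplit₁ (s.get i) xy.1 xy.2, Word.posSplit₂ (s.get i) xy.1 xy.2]))
      + P * (∑ j ∈ Finset.univ.filter (fun j : Fin s.length => i ≠ j),
          ∑ x : Fin (s.get i).length, ∑ y ∈ Word.locs (s.get j) ((s.get i).get x),
            phi N β Λ ((s.set i (Word.negMerge (s.get i) x (s.get j) y)).eraseIdx j))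
      - P * (∑ j ∈ Finset.univ.filter (fun j : Fin s.length => i ≠ j),
          ∑ x : Fin (s.get i).length, ∑ y ∈ Word.locs (s.get j) ((s.get i).get x),
            phi N β Λ ((s.set i (Word.posMerge (s.get i) x (s.get j) y)).eraseIdx j))
      + N * β * (P * N * (∑ x : Fin (s.get i).length, ∑ p ∈ plaquettesAt ((s.get i).get x),
          phi N β Λ (s.replaceAt i [Word.negDeform (s.get i) x p])))
      - N * β * (P * N * (∑ x : Fin (s.get i).length, ∑ p ∈ plaquettesAt ((s.get i).get x),
          phi N β Λ (s.replaceAt i [Word.posDeform (s.get i) x p]))) := by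
    intro i
    have h := symmetrize_component_finiteN hU hd Λ N hN β hs hΛ i
    simp only [sum_front_one N hN0 β Λ s i, sum_front_two N hN0 β Λ s i, sum_front_merge N hN0 β Λ s i,
      ← Finset.mul_sum, soExpect_wilsonProd_eq N hN0 β Λ s, hPn, hPn1, ← hP] at h
    linear_combination h
  have hsum := Finset.sum_congr rfl fun i (_ : i ∈ (Finset.univ : Finset (Fin s.length))) => hcomp i
  rw [← Finset.sum_mul, ← Finset.mul_sum, CoeffCatalanBoundProof.sum_length_get] at hsum
  simp only [Finset.sum_add_distrib, Finset.sum_sub_distrib, ← Finset.mul_sum] at hsum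
  rw [← hTn, ← hTp, ← hSn, ← hSp, ← hDn, ← hDp, ← hMn, ← hMp] at hsum
  -- cancel `P = N^{n−1}` and divide by `N`
  have key : ((N : ℝ) - 1) * (s.len : ℝ) * phi N β Λ s * N =
      N * (∑ o : SameIdx s, phi N β Λ (s.negTwistAt o)) - N * (∑ o : InvIdx s, phi N β Λ (s.posTwistAt o))
      + N * N * (∑ o : InvIdx s, phi N β Λ (s.negSplitAt o)) - N * N * (∑ o : SameIdx s, phi N β Λ (s.posSplitAt o))
      + (∑ o : MergeIdx s, phi N β Λ (s.negMergeAt o)) - (∑ o : MergeIdx s, phi N β Λ (s.posMergeAt o))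
      + N * β * N * (∑ o : DeformIdx s, phi N β Λ (s.negDeformAt o))
      - N * β * N * (∑ o : DeformIdx s, phi N β Λ (s.posDeformAt o)) := by
    refine mul_left_cancel₀ hP0 ?_
    linear_combination hsum
  field_simp
  linear_combination key

end Literature.MathematicalPhysics.QuantumFieldTheory.Chatterjee2019LargeN

end
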